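import Summits.QuantumFields.YangMills.Theorems.UnitScaleTiltProp7TorusAgmonWeight
import HarnessLib

/-!
# Route `UnitScaleTilt`, crux K1 «MinimiserStabilityRegPr» (stmt-QuantumFields-19200), route-R E′ path (α′) — the sup-row residue (hK), row (W3-lite) for the assembly (A), part 1 of 2:
# THE SMOOTH CHORDAL LENGTH `f(x) = √(ℓ² + Σ_μ s_μ(x)²)` ON THE TORUS AS A NAMED SUPPLY — all difference rows through order two, including the MIXED one

Cell `ym3-torus`, D-0154 (3c) twin-width seat `ym-routeR-w2` (gen 5).  THEOREMS ONLY (0 `def`, 0 `sorry`); `--supports stmt-QuantumFields-19200 --as helper`,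
count-neutral.  YM₃ on T³ is a ladder rung (R3), not the Clay problem; nothing here claims the stub, the crux, d = 4 or the gap.

THE POINT (★routeR-w3 g5 19:10:07Z «routeR-w2: (W3-lite) GO»: the scale-ℓ torus cutoff `χ = S(f∕ℓ)` with rows through order two for the `[Δ, χ]` peeling of (A3′)).  Part 2
(`…TorusScaleCutoff`) composes a `C^{1,1}` smoothstep with `f∕ℓ`; the composition's second differences need `f`'s first, pure-second AND mixed-second differences.  This file exports
them once as an existence statement (the `f` of ✓ `Prop7TorusAgmonWeight.exists_admissible_weight`, whose rows were internal there): `ℓ ≤ f ≤ ℓ + tdist`, `f ≥ 2·tdist∕(π√d)`,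
`|δ^±_μ f| ≤ 1`, `|δ²_μ f| ≤ 2∕ℓ`, `|δ_μδ_ν f| ≤ 1∕ℓ` (`μ ≠ ν`).

WHAT IS PROVED (ns `…Theorems.Prop7TorusAgmonWeight`, continued).
* `abs_sqrt_mixed_diff_le` — `g(s,t) = √(B+s²+t²)`: `|g(s₁,t₁) − g(s₁,t₀) − g(s₀,t₁) + g(s₀,t₀)| ≤ 1∕√B` for nonnegative arguments moving by `≤ 1` (the identity
  `δ_sδ_t g = (t₁²−t₀²)·(D(s₀) − D(s₁))∕(D(s₁)D(s₀))`, `D(s) = g(s,t₁)+g(s,t₀) ≥ 2√B`).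
* ★★★ `exists_smooth_length (b) (hℓ : 1 ≤ ℓ) : ∃ f, (∀ x, ℓ ≤ f x) ∧ (first) ∧ (pure second ≤ 2∕ℓ) ∧ (mixed ≤ 1∕ℓ) ∧ (2·tdist∕(π√d) ≤ f) ∧ (f ≤ ℓ + tdist)`.
HONEST SCOPE.  Calculus letters; the cutoff is part 2; (A) is not here.

References: T. Bałaban, CMP 96 (1984) 223–250 [Balaban1984PropagatorsII] ((1.9) p.226).
-/

set_option autoImplicit false

noncomputable section

open scoped BigOperators

namespace Summit.QuantumFields.YangMills.Theorems.Prop7TorusAgmonWeight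

open Literature.MathematicalPhysics.QuantumFieldTheory.Balaban1983to89
open Finset

/-- **MIXED DIFFERENCE of `g(s,t) = √(B + s² + t²)`**: for `s₀, s₁, t₀, t₁ ≥ 0` with `|s₁ − s₀| ≤ 1`, `|t₁ − t₀| ≤ 1`:
`|g(s₁,t₁) − g(s₁,t₀) − g(s₀,t₁) + g(s₀,t₀)| ≤ 1∕√B` (`B > 0`). [folklore] -/
theorem abs_sqrt_mixed_diff_le {B : ℝ} (hB : 0 < B) {s0 s1 t0 t1 : ℝ} (hs0 : 0 ≤ s0) (hs1 : 0 ≤ s1) (ht0 : 0 ≤ t0) (ht1 : 0 ≤ t1)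
    (hs : |s1 - s0| ≤ 1) (ht : |t1 - t0| ≤ 1) :
    |Real.sqrt (B + s1 ^ 2 + t1 ^ 2) - Real.sqrt (B + s1 ^ 2 + t0 ^ 2) - Real.sqrt (B + s0 ^ 2 + t1 ^ 2) + Real.sqrt (B + s0 ^ 2 + t0 ^ 2)| ≤ 1 / Real.sqrt B := by
  have hrB : 0 < Real.sqrt B := Real.sqrt_pos.mpr hB
  -- the four values as `√(B' + t²)` with `B' = B + s²`
  have hB1 : 0 < B + s1 ^ 2 := by positivity
  have hB0 : 0 < B + s0 ^ 2 := by positivity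
  set g11 := Real.sqrt (B + s1 ^ 2 + t1 ^ 2) with e11
  set g10 := Real.sqrt (B + s1 ^ 2 + t0 ^ 2) with e10
  set g01 := Real.sqrt (B + s0 ^ 2 + t1 ^ 2) with e01
  set g00 := Real.sqrt (B + s0 ^ 2 + t0 ^ 2) with e00
  have hg11 : Real.sqrt B ≤ g11 := Real.sqrt_le_sqrt (by nlinarith [sq_nonneg s1, sq_nonneg t1])
  have hg10 : Real.sqrt B ≤ g10 := Real.sqrt_le_sqrt (by nlinarith [sq_nonneg s1, sq_nonneg t0])
  have hg01 : Real.sqrt B ≤ g01 := Real.sqrt_le_sqrt (by nlinarith [sq_nonneg s0, sq_nonneg t1])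
  have hg00 : Real.sqrt B ≤ g00 := Real.sqrt_le_sqrt (by nlinarith [sq_nonneg s0, sq_nonneg t0])
  have ht1le : t1 ≤ g11 := by rw [e11]; calc t1 = Real.sqrt (t1 ^ 2) := (Real.sqrt_sq ht1).symm
    _ ≤ _ := Real.sqrt_le_sqrt (by nlinarith [sq_nonneg s1, hB.le])
  have ht0le : t0 ≤ g10 := by rw [e10]; calc t0 = Real.sqrt (t0 ^ 2) := (Real.sqrt_sq ht0).symm
    _ ≤ _ := Real.sqrt_le_sqrt (by nlinarith [sq_nonneg s1, hB.le])
  -- first differences in `t` at fixed `s`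
  have d1 : g11 - g10 = (t1 ^ 2 - t0 ^ 2) / (g11 + g10) := by
    have := sqrt_add_sq_sub_eq hB1 t1 t0; simpa only [e11, e10] using this
  have d0 : g01 - g00 = (t1 ^ 2 - t0 ^ 2) / (g01 + g00) := by
    have := sqrt_add_sq_sub_eq hB0 t1 t0; simpa only [e01, e00] using this
  -- first differences in `s` at fixed `t`: `|g(s₁,t) − g(s₀,t)| ≤ 1`
  have ds1 : |g01 - g11| ≤ 1 := by
    have h := abs_sqrt_add_sq_sub_le (B := B + t1 ^ 2) (by positivity) hs0 hs1 (by rw [abs_sub_comm]; exact hs)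
    have e1 : B + t1 ^ 2 + s0 ^ 2 = B + s0 ^ 2 + t1 ^ 2 := by ring
    have e2 : B + t1 ^ 2 + s1 ^ 2 = B + s1 ^ 2 + t1 ^ 2 := by ring
    rw [e1, e2] at h; exact h
  have ds0 : |g00 - g10| ≤ 1 := by
    have h := abs_sqrt_add_sq_sub_le (B := B + t0 ^ 2) (by positivity) hs0 hs1 (by rw [abs_sub_comm]; exact hs)
    have e1 : B + t0 ^ 2 + s0 ^ 2 = B + s0 ^ 2 + t0 ^ 2 := by ring
    have e2 : B + t0 ^ 2 + s1 ^ 2 = B + s1 ^ 2 + t0 ^ 2 := by ring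
    rw [e1, e2] at h; exact h
  have hD1 : 0 < g11 + g10 := by linarith
  have hD0 : 0 < g01 + g00 := by linarith
  -- the identity
  have key : g11 - g10 - g01 + g00 = (t1 ^ 2 - t0 ^ 2) * ((g01 + g00) - (g11 + g10)) / ((g11 + g10) * (g01 + g00)) := by
    have e : g11 - g10 - g01 + g00 = (g11 - g10) - (g01 - g00) := by ring
    rw [e, d1, d0]; field_simp
  rw [key, abs_div, abs_mul, abs_of_pos (mul_pos hD1 hD0), div_le_div_iff₀ (mul_pos hD1 hD0) hrB]
  have hA : |t1 ^ 2 - t0 ^ 2| ≤ g11 + g10 := by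
    have e : t1 ^ 2 - t0 ^ 2 = (t1 - t0) * (t1 + t0) := by ring
    rw [e, abs_mul, abs_of_nonneg (by linarith : 0 ≤ t1 + t0)]
    calc |t1 - t0| * (t1 + t0) ≤ 1 * (t1 + t0) := mul_le_mul_of_nonneg_right ht (by linarith)
      _ ≤ g11 + g10 := by linarith
  have hDiff : |(g01 + g00) - (g11 + g10)| ≤ 2 := by
    have e : (g01 + g00) - (g11 + g10) = (g01 - g11) + (g00 - g10) := by ring
    rw [e]; exact (abs_add_le _ _).trans (by linarith)
  calc |t1 ^ 2 - t0 ^ 2| * |(g01 + g00) - (g11 + g10)| * Real.sqrt B ≤ (g11 + g10) * 2 * Real.sqrt B := by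
        apply mul_le_mul_of_nonneg_right _ hrB.le
        exact mul_le_mul hA hDiff (abs_nonneg _) (by linarith)
    _ ≤ 1 * ((g11 + g10) * (g01 + g00)) := by nlinarith

variable {P : Params} {j : ℕ}

/-- ★★★ **THE SMOOTH CHORDAL LENGTH AS A NAMED SUPPLY**: for every base point `b ∈ T^{(j)}` and `ℓ ≥ 1` there is a site function `f` with `ℓ ≤ f`, first differences `≤ 1`,
pure second differences `≤ 2∕ℓ`, mixed second differences `≤ 1∕ℓ`, and `2·tdist(x,b)∕(π√d) ≤ f(x) ≤ ℓ + tdist(x,b)` (it is the `f` behind ✓ `exists_admissible_weight`).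
[cite: Balaban1984PropagatorsII, (1.9) p.226] -/
theorem exists_smooth_length (b : Site P j) {ℓ : ℝ} (hℓ : 1 ≤ ℓ) :
    ∃ f : SiteField P j ℝ, (∀ x, ℓ ≤ f x) ∧
      (∀ x μ, |f (x.shift μ) - f x| ≤ 1 ∧ |f (x.unshift μ) - f x| ≤ 1) ∧
      (∀ x μ, |f (x.shift μ) + f (x.unshift μ) - 2 * f x| ≤ 2 / ℓ) ∧
      (∀ x μ ν, μ ≠ ν → |f ((x.shift μ).shift ν) - f (x.shift μ) - f (x.shift ν) + f x| ≤ 1 / ℓ) ∧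
      (∀ x, 2 / (Real.pi * Real.sqrt P.d) * (Site.tdist x b : ℝ) ≤ f x) ∧
      (∀ x, f x ≤ ℓ + (Site.tdist x b : ℝ)) := by
  classical
  have hπ := Real.pi_pos
  set N : ℕ := P.sitesPerDir j with hN
  have hN0 : (0 : ℝ) < (N : ℝ) := by exact_mod_cast NeZero.pos N
  have hℓ0 : 0 < ℓ := by linarith
  set ch : ℝ → ℝ := fun τ => (N : ℝ) / Real.pi * |Real.sin (Real.pi * τ / N)| with hch
  have hch0 : ∀ τ, 0 ≤ ch τ := fun τ => by rw [hch]; positivity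
  set t : Site P j → Fin P.d → ℝ := fun x μ => (((x μ - b μ).val : ℕ) : ℝ) with ht
  set f : Site P j → ℝ := fun x => Real.sqrt (ℓ ^ 2 + ∑ μ, ch (t x μ) ^ 2) with hf
  have hfℓ : ∀ x, ℓ ≤ f x := fun x => by
    rw [hf]; calc ℓ = Real.sqrt (ℓ ^ 2) := (Real.sqrt_sq hℓ0.le).symm
      _ ≤ Real.sqrt (ℓ ^ 2 + ∑ μ, ch (t x μ) ^ 2) := Real.sqrt_le_sqrt (by linarith [Finset.sum_nonneg fun μ (_ : μ ∈ Finset.univ) => sq_nonneg (ch (t x μ))])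
  have hshift : ∀ x μ, ch (t (x.shift μ) μ) = ch (t x μ + 1) ∧ ch (t (x.unshift μ) μ) = ch (t x μ - 1) := by
    intro x μ
    obtain ⟨q₁, hq₁⟩ := exists_val_shift x b μ
    obtain ⟨q₂, hq₂⟩ := exists_val_unshift x b μ
    have e1 : t (x.shift μ) μ = (t x μ + 1) + (N : ℝ) * q₁ := by simp only [ht]; exact_mod_cast hq₁
    have e2 : t (x.unshift μ) μ = (t x μ - 1) + (N : ℝ) * q₂ := by simp only [ht]; exact_mod_cast hq₂
    exact ⟨by rw [e1]; exact chord_periodic hN0 _ _, by rw [e2]; exact chord_periodic hN0 _ _⟩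
  have hother : ∀ x μ ν, ν ≠ μ → t (x.shift μ) ν = t x ν ∧ t (x.unshift μ) ν = t x ν := by
    intro x μ ν h
    obtain ⟨h1, h2⟩ := shift_apply_ne' x (μ := μ) (ν := ν) h
    refine ⟨?_, ?_⟩ <;> simp only [ht, h1, h2]
  have hsplit : ∀ (x : Site P j) (μ : Fin P.d), ℓ ^ 2 + ∑ ν, ch (t x ν) ^ 2 = (ℓ ^ 2 + ∑ ν ∈ Finset.univ.erase μ, ch (t x ν) ^ 2) + ch (t x μ) ^ 2 := by
    intro x μ; rw [← Finset.add_sum_erase _ _ (Finset.mem_univ μ)]; ring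
  have hB : ∀ (x : Site P j) (μ : Fin P.d), ℓ ^ 2 ≤ ℓ ^ 2 + ∑ ν ∈ Finset.univ.erase μ, ch (t x ν) ^ 2 := fun x μ => by
    linarith [Finset.sum_nonneg fun ν (_ : ν ∈ Finset.univ.erase μ) => sq_nonneg (ch (t x ν))]
  have hBshift : ∀ (x : Site P j) (μ : Fin P.d), ∑ ν ∈ Finset.univ.erase μ, ch (t (x.shift μ) ν) ^ 2 = ∑ ν ∈ Finset.univ.erase μ, ch (t x ν) ^ 2
      ∧ ∑ ν ∈ Finset.univ.erase μ, ch (t (x.unshift μ) ν) ^ 2 = ∑ ν ∈ Finset.univ.erase μ, ch (t x ν) ^ 2 := by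
    intro x μ
    constructor <;> refine Finset.sum_congr rfl fun ν hν => ?_ <;> have h := Finset.ne_of_mem_erase hν
    · rw [(hother x μ ν h).1]
    · rw [(hother x μ ν h).2]
  have hdf : ∀ x μ, |f (x.shift μ) - f x| ≤ 1 ∧ |f (x.unshift μ) - f x| ≤ 1 ∧ |f (x.shift μ) + f (x.unshift μ) - 2 * f x| ≤ 2 / ℓ := by
    intro x μ
    set B : ℝ := ℓ ^ 2 + ∑ ν ∈ Finset.univ.erase μ, ch (t x ν) ^ 2 with hBdef
    have hBpos : 0 < B := lt_of_lt_of_le (by positivity) (hB x μ)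
    have eF : f x = Real.sqrt (B + ch (t x μ) ^ 2) := by rw [hf]; simp only; rw [hsplit x μ]
    have eP : f (x.shift μ) = Real.sqrt (B + ch (t x μ + 1) ^ 2) := by
      rw [hf]; simp only; rw [hsplit (x.shift μ) μ, (hBshift x μ).1, (hshift x μ).1]
    have eM : f (x.unshift μ) = Real.sqrt (B + ch (t x μ - 1) ^ 2) := by
      rw [hf]; simp only; rw [hsplit (x.unshift μ) μ, (hBshift x μ).2, (hshift x μ).2]
    have d1 : |ch (t x μ + 1) - ch (t x μ)| ≤ 1 := abs_chord_succ_sub_le hN0 _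
    have d2 : |ch (t x μ - 1) - ch (t x μ)| ≤ 1 := by
      have := abs_chord_succ_sub_le hN0 (t x μ - 1)
      rw [sub_add_cancel] at this; rwa [abs_sub_comm] at this
    have d3 : |ch (t x μ + 1) ^ 2 + ch (t x μ - 1) ^ 2 - 2 * ch (t x μ) ^ 2| ≤ 2 := abs_chord_sq_second_diff_le hN0 _
    rw [eF, eP, eM]
    refine ⟨abs_sqrt_add_sq_sub_le hBpos (hch0 _) (hch0 _) d1, abs_sqrt_add_sq_sub_le hBpos (hch0 _) (hch0 _) d2, ?_⟩
    have h2 := abs_sqrt_add_sq_second_diff_le hBpos (hch0 _) (hch0 _) (hch0 _) d1 d2 d3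
    refine h2.trans ?_
    have hsB : ℓ ≤ Real.sqrt B := by
      calc ℓ = Real.sqrt (ℓ ^ 2) := (Real.sqrt_sq hℓ0.le).symm
        _ ≤ Real.sqrt B := Real.sqrt_le_sqrt (hB x μ)
    exact div_le_div_of_nonneg_left (by norm_num) hℓ0 hsB
  -- the mixed second difference
  have hmixed : ∀ x μ ν, μ ≠ ν → |f ((x.shift μ).shift ν) - f (x.shift μ) - f (x.shift ν) + f x| ≤ 1 / ℓ := by
    intro x μ ν hμν
    -- split off the `μ`-th and `ν`-th squares
    set R : Finset (Fin P.d) := (Finset.univ.erase μ).erase ν with hR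
    have hνR : ν ∈ Finset.univ.erase μ := Finset.mem_erase.mpr ⟨fun h => hμν h.symm, Finset.mem_univ ν⟩
    have hsplit2 : ∀ y : Site P j, ℓ ^ 2 + ∑ κ, ch (t y κ) ^ 2 = (ℓ ^ 2 + ∑ κ ∈ R, ch (t y κ) ^ 2) + ch (t y μ) ^ 2 + ch (t y ν) ^ 2 := by
      intro y
      rw [hsplit y μ, ← Finset.add_sum_erase _ _ hνR, hR]; ring
    set B : ℝ := ℓ ^ 2 + ∑ κ ∈ R, ch (t x κ) ^ 2 with hBdef
    have hBℓ : ℓ ^ 2 ≤ B := by rw [hBdef]; linarith [Finset.sum_nonneg fun κ (_ : κ ∈ R) => sq_nonneg (ch (t x κ))]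
    have hBpos : 0 < B := lt_of_lt_of_le (by positivity) hBℓ
    -- the remaining coordinates do not move under either shift
    have hRfix : ∀ y : Site P j, ∀ ρ : Fin P.d, (ρ = μ ∨ ρ = ν) → ∑ κ ∈ R, ch (t (y.shift ρ) κ) ^ 2 = ∑ κ ∈ R, ch (t y κ) ^ 2 := by
      intro y ρ hρ
      refine Finset.sum_congr rfl fun κ hκ => ?_
      have hκν : κ ≠ ν := Finset.ne_of_mem_erase hκ
      have hκμ : κ ≠ μ := Finset.ne_of_mem_erase (Finset.mem_of_mem_erase hκ)
      rcases hρ with rfl | rfl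
      · rw [(hother y _ κ hκμ).1]
      · rw [(hother y _ κ hκν).1]
    -- labels: μ-coordinate moves under `shift μ` only, ν-coordinate under `shift ν` only
    have eμ1 : ch (t (x.shift μ) μ) = ch (t x μ + 1) := (hshift x μ).1
    have eν1 : ch (t (x.shift ν) ν) = ch (t x ν + 1) := (hshift x ν).1
    have eμν : ch (t (x.shift μ) ν) = ch (t x ν) := by rw [(hother x μ ν (Ne.symm hμν)).1]
    have eνμ : ch (t (x.shift ν) μ) = ch (t x μ) := by rw [(hother x ν μ hμν).1]
    have e2μ : ch (t ((x.shift μ).shift ν) μ) = ch (t x μ + 1) := by rw [(hother (x.shift μ) ν μ hμν).1, eμ1]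
    have e2ν : ch (t ((x.shift μ).shift ν) ν) = ch (t x ν + 1) := by rw [(hshift (x.shift μ) ν).1, (hother x μ ν (Ne.symm hμν)).1]
    have hR2 : ∑ κ ∈ R, ch (t ((x.shift μ).shift ν) κ) ^ 2 = ∑ κ ∈ R, ch (t x κ) ^ 2 := by
      rw [hRfix (x.shift μ) ν (Or.inr rfl), hRfix x μ (Or.inl rfl)]
    have g11 : f ((x.shift μ).shift ν) = Real.sqrt (B + ch (t x μ + 1) ^ 2 + ch (t x ν + 1) ^ 2) := by
      rw [hf]; simp only; rw [hsplit2, hR2, e2μ, e2ν]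
    have g10 : f (x.shift μ) = Real.sqrt (B + ch (t x μ + 1) ^ 2 + ch (t x ν) ^ 2) := by
      rw [hf]; simp only; rw [hsplit2, hRfix x μ (Or.inl rfl), eμ1, eμν]
    have g01 : f (x.shift ν) = Real.sqrt (B + ch (t x μ) ^ 2 + ch (t x ν + 1) ^ 2) := by
      rw [hf]; simp only; rw [hsplit2, hRfix x ν (Or.inr rfl), eνμ, eν1]
    have g00 : f x = Real.sqrt (B + ch (t x μ) ^ 2 + ch (t x ν) ^ 2) := by
      rw [hf]; simp only; rw [hsplit2]
    rw [g11, g10, g01, g00]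
    have dμ : |ch (t x μ + 1) - ch (t x μ)| ≤ 1 := abs_chord_succ_sub_le hN0 _
    have dν : |ch (t x ν + 1) - ch (t x ν)| ≤ 1 := abs_chord_succ_sub_le hN0 _
    have h := abs_sqrt_mixed_diff_le hBpos (hch0 (t x μ)) (hch0 (t x μ + 1)) (hch0 (t x ν)) (hch0 (t x ν + 1)) dμ dν
    refine h.trans ?_
    have hsB : ℓ ≤ Real.sqrt B := by
      calc ℓ = Real.sqrt (ℓ ^ 2) := (Real.sqrt_sq hℓ0.le).symm
        _ ≤ Real.sqrt B := Real.sqrt_le_sqrt hBℓ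
    exact div_le_div_of_nonneg_left (by norm_num) hℓ0 hsB
  -- the pinch
  have hcoordlo : ∀ x μ, 2 / Real.pi * ((min (x μ - b μ).val (b μ - x μ).val : ℕ) : ℝ) ≤ ch (t x μ) := by
    intro x μ
    have e : b μ - x μ = -(x μ - b μ) := by ring
    rw [e, min_val_eq]
    have h0 : 0 ≤ t x μ := by simp only [ht]; positivity
    have h1 : t x μ ≤ N := by simp only [ht]; exact_mod_cast (ZMod.val_lt _).le
    exact (chord_compare hN0 h0 h1).1
  have hcoordhi : ∀ x μ, ch (t x μ) ≤ ((min (x μ - b μ).val (b μ - x μ).val : ℕ) : ℝ) := by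
    intro x μ
    have e : b μ - x μ = -(x μ - b μ) := by ring
    rw [e, min_val_eq]
    have h0 : 0 ≤ t x μ := by simp only [ht]; positivity
    have h1 : t x μ ≤ N := by simp only [ht]; exact_mod_cast (ZMod.val_lt _).le
    exact (chord_compare hN0 h0 h1).2
  refine ⟨f, hfℓ, fun x μ => ⟨(hdf x μ).1, (hdf x μ).2.1⟩, fun x μ => (hdf x μ).2.2, hmixed, fun x => ?_, fun x => ?_⟩
  · have hd : (1 : ℝ) ≤ P.d := by exact_mod_cast P.hd
    have hsd : 0 < Real.sqrt P.d := Real.sqrt_pos.mpr (by linarith)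
    have hsum : 2 / Real.pi * (Site.tdist x b : ℝ) ≤ ∑ μ, ch (t x μ) := by
      simp only [Site.tdist, Nat.cast_sum, Finset.mul_sum]
      exact Finset.sum_le_sum fun μ _ => hcoordlo x μ
    have hcs : ∑ μ, ch (t x μ) ≤ Real.sqrt P.d * f x := by
      have h := Finset.sum_mul_sq_le_sq_mul_sq (Finset.univ : Finset (Fin P.d)) (fun _ => (1 : ℝ)) (fun μ => ch (t x μ))
      simp only [one_pow, one_mul, Finset.sum_const, Finset.card_univ, Fintype.card_fin, nsmul_eq_mul, mul_one] at h
      have h0 : 0 ≤ ∑ μ, ch (t x μ) := Finset.sum_nonneg fun μ _ => hch0 _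
      have hS : ∑ μ, ch (t x μ) ^ 2 ≤ f x ^ 2 := by
        rw [hf]; simp only; rw [Real.sq_sqrt (by positivity)]; nlinarith
      calc ∑ μ, ch (t x μ) = Real.sqrt ((∑ μ, ch (t x μ)) ^ 2) := (Real.sqrt_sq h0).symm
        _ ≤ Real.sqrt ((P.d : ℝ) * f x ^ 2) := Real.sqrt_le_sqrt (h.trans (by nlinarith))
        _ = Real.sqrt P.d * f x := by rw [Real.sqrt_mul (by positivity), Real.sqrt_sq (by linarith [hfℓ x])]
    calc 2 / (Real.pi * Real.sqrt P.d) * (Site.tdist x b : ℝ) = (Real.sqrt P.d)⁻¹ * (2 / Real.pi * (Site.tdist x b : ℝ)) := by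
          field_simp
      _ ≤ (Real.sqrt P.d)⁻¹ * (Real.sqrt P.d * f x) := mul_le_mul_of_nonneg_left (hsum.trans hcs) (by positivity)
      _ = f x := by field_simp
  · have hsum : ∑ μ, ch (t x μ) ≤ (Site.tdist x b : ℝ) := by
      simp only [Site.tdist, Nat.cast_sum]
      exact Finset.sum_le_sum fun μ _ => hcoordhi x μ
    have hS : ∑ μ, ch (t x μ) ^ 2 ≤ (∑ μ, ch (t x μ)) ^ 2 :=
      Finset.sum_sq_le_sq_sum_of_nonneg fun μ _ => hch0 _
    have h0 : 0 ≤ ∑ μ, ch (t x μ) := Finset.sum_nonneg fun μ _ => hch0 _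
    have hfx : f x ≤ ℓ + ∑ μ, ch (t x μ) := by
      rw [hf]; simp only
      rw [Real.sqrt_le_left (by positivity)]
      nlinarith
    linarith

end Summit.QuantumFields.YangMills.Theorems.Prop7TorusAgmonWeight

end
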